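import Summits.BirchSwinnertonDyer.Rank1Residual.P2.CongruentNumberEvenPairAokiMonsky
import Summits.BirchSwinnertonDyer.Rank1Residual.P2.CongruentNumberSilentEvenFiveEnclosureRungTwo
import Summits.BirchSwinnertonDyer.Rank1Residual.P2.CongruentNumberPairsAtTwoEvenThreePrimesDoor
import Literature.NumberTheory.QuadraticFields.RedeiReichardtFourRank
import HarnessLib

/-!
# Cell «bsd-monsky» (prover-A): THE `k = 2` RUNG OF THE UNIFORM EVEN MONSKY LAW C-P2-2 FROM THE 𝒮⁻ ENCLOSURE
# WITH AOKI'S REFEREED SELMER COUNT — `CongruentEvenBSDTwoAt 2` / `CongruentEvenOrdTwoAt 2` relative to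
# {U⁺, GZK, `hAo`, `hSys′`} and the silent rung relative to {`hAo`, `hSys′`}: no Heath-Brown 1994 binder, no
# Rédei–Reichardt binder (nothing asserted)

HONEST FRAMING: nothing asserted; every theorem is conditional on displayed named facts (`hAo` = Aoki 1999
Thm. 2.2, refereed and completely proved in print; `hSys′` = Tian's CM-point system on `𝒮⁻` in genus form,
`Tian2014.tian2014_system_sMinus_genus`; `hU` = TYZ Thm. 1.2 in its `ρ`-free form U⁺, the binder of DOOR B6,
verbatim; `hGZK`). The typer's rung file `P2/CongruentNumberSilentEvenFiveEnclosureRungTwo.lean` (p404283) composes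
the enclosure with the sub-lane's rung bookkeeping modulo {U⁺, GZK, `hMe`, `hR`, `hSys′`}, where `hMe` (the even
case of Monsky's matrix theorem, printed as a sketch) enters ONLY through «`s(n) = 1 ⟹ #Sel₂(E_n) = 8`» on the loud
cells (DOOR B6) and in the `ord` form. This file abstracts that use into ONE hypothesis `hsel` — the `k = 2`
Selmer-eight input «`s(t) = 1 ⟹ #Sel₂(E_{2t₀t₁}) = 8`» — proves the two doors at `k = 2` from `hsel`, and supplies
`hsel` from `hAo` (`P2/CongruentNumberEvenPairAokiMonsky.lean`: Aoki = Monsky at `k = 2`) or from `hMe`; the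
Rédei–Reichardt binder is instantiated by the tree theorem `redeiReichardt_fourTwoCard_classGroup_holds` (p405187).

* §1 `hsel` from `hAo` (`selmerEightAtTwo_of_aoki`) and from `hMe` (`selmerEightAtTwo_of_monskyEven`).
* §2 the even door over census vocabulary at `k = 2` from `hsel` (`rankOne_sha_bsdp_two_iff_…_two_of_selmerEight`,
  the `k = 2` case of the sub-lane's `rankOne_sha_bsdp_two_iff_congruentNumberCurve_two_mul_prod`) and DOOR B6 at
  `k = 2` (`…_of_odd_genusSum₂'_of_selmerEight`).
* §3 the rung: C-P2-1 ⟹ `CongruentEvenBSDTwoAt 2` modulo {U⁺, GZK, `hsel`} (silent cells: the typer's/sub-lane's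
  bookkeeping with `hR` instantiated; loud cells: DOOR B6), `CongruentEvenBSDTwoAt 2 ⟹ CongruentEvenOrdTwoAt 2`
  modulo {GZK, `hsel`} (the law file's argument at `k = 2`).
* §4 the compositions with the 𝒮⁻ enclosure: **`CongruentSilentEvenBSDTwoAt 2` from {`hAo`, `hSys′`};
  `CongruentEvenBSDTwoAt 2` and `CongruentEvenOrdTwoAt 2` from {U⁺, GZK, `hAo`, `hSys′`}** — and the `hMe` twins
  without `hR`.
The rungs `k ≥ 3` are NOT touched (README §3). Nothing booked.
References: [Aoki1999] Thm. 2.2 p. 81; [Monsky1990MockHeegner] p. 67 Remark (3); [TianYuanZhang2017] Thm. 1.2,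
Thm. 3.3, Thm. 3.5, §1 (1.1); [HeathBrown1994SelmerCongruentII] Appendix (Monsky) p. 41; [SilvermanAEC2009] Thm. X.4.2;
[Miller2011LMS] Def. 1.1; [LiMa2008] Thm. 0.4.
-/

noncomputable section

open scoped Classical

open WeierstrassCurve Literature.NumberTheory.EllipticCurves
  Literature.NumberTheory.EllipticCurves.Aoki1999
  Literature.NumberTheory.EllipticCurves.Rank1Residual
  Literature.NumberTheory.EllipticCurves.Rank1Residual.Typed
  Literature.NumberTheory.EllipticCurves.HeathBrown1994
  Literature.NumberTheory.EllipticCurves.TianYuanZhang2017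
  Literature.NumberTheory.QuadraticFields.RedeiReichardt

set_option autoImplicit false

namespace Summit.BirchSwinnertonDyer.Rank1Residual.P2

open Conjectures Literature.NumberTheory.EllipticCurves.Tian2014

/-! ## §1 The `k = 2` Selmer-eight input from Aoki's fact, and from Monsky's -/

/-- **`s(t) = 1 ⟹ #Sel₂(E_{2t₀t₁}) = 8` on every `k = 2` cell, from Aoki's Theorem 2.2** (Aoki = Monsky at `k = 2`).
[cite: Aoki1999, Thm. 2.2 p. 81] [cite: HeathBrown1994SelmerCongruentII, Appendix (Monsky), typescript p. 41 L20–L36] -/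
theorem selmerEightAtTwo_of_aoki (hAo : thm22_card_selmerGroup_two) :
    ∀ t : Fin 2 → ℕ, (∀ i, (t i).Prime) → Function.Injective t → (2 * ∏ i, t i) % 8 = 6 →
      monskySelmerRankEven t = 1 →
      Nat.card ((congruentNumberCurve (2 * ∏ i, t i)).selmerGroup 2) = 8 := by
  intro t ht hinj h8 hs
  rw [card_selmerGroup_two_two_mul_prod_two_of_aoki hAo t ht hinj h8, hs]
  norm_num

/-- The same input from Heath-Brown 1994's formula (`hMe`), for comparison.
[cite: HeathBrown1994SelmerCongruentII, Appendix (Monsky), typescript p. 41 L20–L36] -/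
theorem selmerEightAtTwo_of_monskyEven (hMe : monsky_card_selmerGroup_two_even) :
    ∀ t : Fin 2 → ℕ, (∀ i, (t i).Prime) → Function.Injective t → (2 * ∏ i, t i) % 8 = 6 →
      monskySelmerRankEven t = 1 →
      Nat.card ((congruentNumberCurve (2 * ∏ i, t i)).selmerGroup 2) = 8 := by
  intro t ht hinj h8 hs
  rw [hMe 2 t ht (odd_of_two_mul_prod_mod_eight_six t rfl h8) hinj, hs]
  norm_num

/-! ## §2 The even door over census vocabulary at `k = 2`, from the Selmer-eight input -/

/-- **THE EVEN DOOR AT `k = 2` FROM THE SELMER-EIGHT INPUT** (the sub-lane's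
`rankOne_sha_bsdp_two_iff_congruentNumberCurve_two_mul_prod` with `hMe` replaced by `hsel`): for distinct primes
`t₀, t₁` with `n = 2t₀t₁ ≡ 6 (mod 8)`, `s(t) = 1`, and ANY rank-one datum `L′(E_n, 1) = x·Ω·Reg`, `x ≠ 0`:
`ord_{s=1} L = 1`, rank `1`, `Ш[2^∞] = 0`, and `BSD(E_n, 2) ⟺ ord₂ x = 2·2 − 2 = 2`.
[cite: SilvermanAEC2009, Thm. X.4.2] [cite: Miller2011LMS, Def. 1.1 (arXiv:1010.2431 p. 3)] -/
theorem rankOne_sha_bsdp_two_iff_congruentNumberCurve_two_mul_prod_two_of_selmerEight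
    (hGZK : rank_eq_analyticRank_of_analyticRank_le_one)
    (hsel : ∀ t : Fin 2 → ℕ, (∀ i, (t i).Prime) → Function.Injective t → (2 * ∏ i, t i) % 8 = 6 →
      monskySelmerRankEven t = 1 →
      Nat.card ((congruentNumberCurve (2 * ∏ i, t i)).selmerGroup 2) = 8)
    (p : Fin 2 → ℕ) (hp : ∀ i, (p i).Prime) (hinj : Function.Injective p) {n : ℕ} (hn : 2 * ∏ i, p i = n)
    (h8 : n % 8 = 6) (hs : monskySelmerRankEven p = 1) {x : ℚ} (hx0 : x ≠ 0)
    (hx : deriv (congruentNumberCurve n).entireLFunction 1 =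
      (x : ℂ) * ((congruentNumberCurve n).realPeriodRat : ℂ) *
        ((congruentNumberCurve n).regulator : ℂ)) :
    (congruentNumberCurve n).analyticRank = 1 ∧ (congruentNumberCurve n).mordellWeilRank = 1 ∧
      AddCommGroup.primaryComponent (congruentNumberCurve n).sha 2 = ⊥ ∧
      (BSDp (congruentNumberCurve n) 2 ↔ padicValRat 2 x = 2) := by
  have hodd : ∀ i, Odd (p i) := odd_of_two_mul_prod_mod_eight_six p hn h8
  have hsq : Squarefree n := hn ▸ squarefree_two_mul_prod_of_injective p hp hodd hinj
  have hn0 : n ≠ 0 := hsq.ne_zero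
  haveI := isElliptic_congruentNumberCurve hn0
  haveI : Fact (Nat.Prime 2) := ⟨Nat.prime_two⟩
  have hΩ : ((congruentNumberCurve n).realPeriodRat : ℂ) ≠ 0 := by
    exact_mod_cast (congruentNumberCurve n).realPeriodRat_pos_holds.ne'
  have hR : ((congruentNumberCurve n).regulator : ℂ) ≠ 0 := by
    exact_mod_cast (congruentNumberCurve n).regulator_pos'.ne'
  have hder : deriv (congruentNumberCurve n).entireLFunction 1 ≠ 0 := by
    rw [hx]
    exact mul_ne_zero (mul_ne_zero (by exact_mod_cast hx0) hΩ) hR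
  have hr1 : (congruentNumberCurve n).analyticRank = 1 :=
    analyticRank_congruentNumberCurve_eq_one_of_deriv_ne_zero hsq (Or.inr (Or.inl h8)) hder
  obtain ⟨hrank, -⟩ := hGZK (congruentNumberCurve n) (le_of_eq hr1)
  rw [hr1] at hrank
  have hsel' : Nat.card ((congruentNumberCurve n).selmerGroup 2) = 8 := by
    subst hn
    exact hsel p hp hinj h8 hs
  have hbot := primaryComponent_sha_two_eq_bot_of_card_selmerGroup_eq_eight hn0 hrank hsel'
  refine ⟨hr1, hrank, hbot, ?_⟩
  rw [bsdp_two_iff_of_LDerivOverOmegaReg_of_sha_two_eq_bot_of_torsionOrder_eq_four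
    (congruentNumberCurve n) hGZK hr1 hx hbot (torsionOrder_congruentNumberCurve hsq),
    tamagawaProduct_congruentNumberCurve_two_mul_prod p hp hodd hinj hn, padicValNat.prime_pow]
  push_cast
  omega

/-- **DOOR B6 AT `k = 2` FROM THE SELMER-EIGHT INPUT** (the law file's
`rankOne_sha_bsdp_two_congruentNumberCurve_two_mul_prod_of_odd_genusSum₂'` with `hMe` replaced by `hsel`): on a
loud `s = 1` cell (`Σ₂′(n)` odd) U⁺ gives the rank-one datum with `𝓛` odd, and the door closes.
[cite: TianYuanZhang2017, Thm. 1.2, Thm. 3.5 and §1 (1.1)] [cite: Miller2011LMS, Def. 1.1 (arXiv:1010.2431 p. 3)] -/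
theorem rankOne_sha_bsdp_two_congruentNumberCurve_two_mul_prod_two_of_odd_genusSum₂'_of_selmerEight
    (hU : ∀ (n : ℕ), Squarefree n → (n % 8 = 5 ∨ n % 8 = 6 ∨ n % 8 = 7) →
      ∃ L : ℤ, IsScriptL n L ∧
        ((n % 8 = 5 ∨ n % 8 = 7) → (2 : ℤ) ∣ L →
          Even (genusSum₁ n fun d => genusClassNumber (GenusField d)) ∧
          Even (genusSum₂' n fun d => genusClassNumber (GenusField d))) ∧
        (n % 8 = 6 → (2 : ℤ) ∣ L → Even (genusSum₂' n fun d => genusClassNumber (GenusField d))))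
    (hGZK : rank_eq_analyticRank_of_analyticRank_le_one)
    (hsel : ∀ t : Fin 2 → ℕ, (∀ i, (t i).Prime) → Function.Injective t → (2 * ∏ i, t i) % 8 = 6 →
      monskySelmerRankEven t = 1 →
      Nat.card ((congruentNumberCurve (2 * ∏ i, t i)).selmerGroup 2) = 8)
    (p : Fin 2 → ℕ) (hp : ∀ i, (p i).Prime) (hinj : Function.Injective p) {n : ℕ}
    (hn : 2 * ∏ i, p i = n) (h8 : n % 8 = 6) (hs : monskySelmerRankEven p = 1)
    (hgen : Odd (genusSum₂' n fun d => genusClassNumber (GenusField d))) :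
    (congruentNumberCurve n).analyticRank = 1 ∧ (congruentNumberCurve n).mordellWeilRank = 1 ∧
      AddCommGroup.primaryComponent (congruentNumberCurve n).sha 2 = ⊥ ∧
      BSDp (congruentNumberCurve n) 2 := by
  have hodd : ∀ i, Odd (p i) := odd_of_two_mul_prod_mod_eight_six p hn h8
  have hsq : Squarefree n := hn ▸ squarefree_two_mul_prod_of_injective p hp hodd hinj
  obtain ⟨L, hLodd, -, hderiv⟩ := rankOneDatum_of_uPlus_six hU hsq h8 hgen
  have hL0 : (L : ℚ) ≠ 0 := by
    have hL0' : L ≠ 0 := fun h => by simp [h] at hLodd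
    exact_mod_cast hL0'
  have hx0 : (2 : ℚ) ^ twoExponent n * (L : ℚ) ^ 2 ≠ 0 :=
    mul_ne_zero (zpow_ne_zero _ two_ne_zero) (pow_ne_zero _ hL0)
  have hx : deriv (congruentNumberCurve n).entireLFunction 1 =
      (((2 : ℚ) ^ twoExponent n * (L : ℚ) ^ 2 : ℚ) : ℂ) *
        ((congruentNumberCurve n).realPeriodRat : ℂ) * ((congruentNumberCurve n).regulator : ℂ) := by
    rw [hderiv]; push_cast; ring
  obtain ⟨hr1, hrank, hbot, hiff⟩ :=
    rankOne_sha_bsdp_two_iff_congruentNumberCurve_two_mul_prod_two_of_selmerEight hGZK hsel p hp hinj hn h8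
      hs hx0 hx
  refine ⟨hr1, hrank, hbot, hiff.mpr ?_⟩
  rw [padicValRat_two_zpow_mul_sq hLodd, ← hn, twoExponent_two_mul_prod_eq p hp hodd hinj]
  norm_num

/-! ## §3 The `k = 2` rung from C-P2-1 and the Selmer-eight input (Rédei–Reichardt instantiated) -/

/-- **C-P2-1 ⟹ RUNG TWO `CongruentEvenBSDTwoAt 2`, modulo {U⁺ `hU`, GZK, `hsel`}** — silent cells (`Σ₂′` even) by the
sub-lane's bookkeeping with the Rédei–Reichardt binder instantiated by the tree theorem, loud cells by DOOR B6 at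
`k = 2` from `hsel`. Asserts nothing; `hU` is a displayed hypothesis, not a fact of the tree.
[cite: TianYuanZhang2017, Thm. 1.2, Thm. 3.5] [cite: Monsky1990MockHeegner, p. 67 Rem. (3)] [cite: LiMa2008, Thm. 0.4]
[cite: Miller2011LMS, Def. 1.1 (arXiv:1010.2431 p. 3)] -/
theorem congruentEvenBSDTwoAt_two_of_congruentSilentEvenFiveBSDTwo_of_selmerEight
    (hU : ∀ (n : ℕ), Squarefree n → (n % 8 = 5 ∨ n % 8 = 6 ∨ n % 8 = 7) →
      ∃ L : ℤ, IsScriptL n L ∧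
        ((n % 8 = 5 ∨ n % 8 = 7) → (2 : ℤ) ∣ L →
          Even (genusSum₁ n fun d => genusClassNumber (GenusField d)) ∧
          Even (genusSum₂' n fun d => genusClassNumber (GenusField d))) ∧
        (n % 8 = 6 → (2 : ℤ) ∣ L → Even (genusSum₂' n fun d => genusClassNumber (GenusField d))))
    (hGZK : rank_eq_analyticRank_of_analyticRank_le_one)
    (hsel : ∀ t : Fin 2 → ℕ, (∀ i, (t i).Prime) → Function.Injective t → (2 * ∏ i, t i) % 8 = 6 →
      monskySelmerRankEven t = 1 →
      Nat.card ((congruentNumberCurve (2 * ∏ i, t i)).selmerGroup 2) = 8)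
    (h : CongruentSilentEvenFiveBSDTwo) : CongruentEvenBSDTwoAt 2 := by
  intro p hp hinj h8 hs
  rcases Nat.even_or_odd (genusSum₂' (2 * ∏ i, p i) fun d => genusClassNumber (GenusField d)) with
    hev | hod
  · exact congruentSilentEvenBSDTwoAt_two_of_congruentSilentEvenFiveBSDTwo
      redeiReichardt_fourTwoCard_classGroup_holds h p hp hinj h8 hs hev
  · obtain ⟨hr1, -, -, hb⟩ :=
      rankOne_sha_bsdp_two_congruentNumberCurve_two_mul_prod_two_of_odd_genusSum₂'_of_selmerEight hU hGZK hsel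
        p hp hinj rfl h8 hs hod
    exact ⟨hr1, hb⟩

/-- **RUNG TWO: observable ⟹ sharper (`CongruentEvenBSDTwoAt 2 ⟹ CongruentEvenOrdTwoAt 2`), modulo GZK and the
Selmer-eight input** — the law file's `congruentEvenOrdTwoAt_of_bsdTwoAt` at `k = 2` with `hMe` replaced by `hsel`.
[cite: SilvermanAEC2009, Thm. X.4.2] [cite: Miller2011LMS, Def. 1.1 (arXiv:1010.2431 p. 3)] -/
theorem congruentEvenOrdTwoAt_two_of_bsdTwoAt_of_selmerEight
    (hGZK : rank_eq_analyticRank_of_analyticRank_le_one)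
    (hsel : ∀ t : Fin 2 → ℕ, (∀ i, (t i).Prime) → Function.Injective t → (2 * ∏ i, t i) % 8 = 6 →
      monskySelmerRankEven t = 1 →
      Nat.card ((congruentNumberCurve (2 * ∏ i, t i)).selmerGroup 2) = 8)
    (h : CongruentEvenBSDTwoAt 2) : CongruentEvenOrdTwoAt 2 := by
  intro p hp hinj h8 hs
  have hodd : ∀ i, Odd (p i) := odd_of_two_mul_prod_mod_eight_six p rfl h8
  have hsq : Squarefree (2 * ∏ i, p i) := squarefree_two_mul_prod_of_injective p hp hodd hinj
  have hn0 : 2 * ∏ i, p i ≠ 0 := hsq.ne_zero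
  haveI := isElliptic_congruentNumberCurve hn0
  haveI : Fact (Nat.Prime 2) := ⟨Nat.prime_two⟩
  obtain ⟨hr1, hbsd⟩ := h p hp hinj h8 hs
  obtain ⟨-, -, y, hy, hval⟩ := hbsd
  obtain ⟨hrank, -⟩ := hGZK (congruentNumberCurve (2 * ∏ i, p i)) (le_of_eq hr1)
  rw [hr1] at hrank
  have hsel' : Nat.card ((congruentNumberCurve (2 * ∏ i, p i)).selmerGroup 2) = 8 := hsel p hp hinj h8 hs
  have hbot := primaryComponent_sha_two_eq_bot_of_card_selmerGroup_eq_eight hn0 hrank hsel'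
  have hcard : Nat.card
      (AddCommGroup.primaryComponent (congruentNumberCurve (2 * ∏ i, p i)).sha 2) = 1 := by
    rw [hbot]; exact AddSubgroup.card_bot
  rw [hcard, padicValNat_one_right, Nat.cast_zero] at hval
  obtain ⟨hlead, hder⟩ := leadingLCoeff_eq_deriv_of_analyticRank_eq_one hr1
  have hT := torsionOrder_congruentNumberCurve hsq
  have htam : (congruentNumberCurve (2 * ∏ i, p i)).tamagawaProduct = 2 ^ (2 * 2 + 2) :=
    tamagawaProduct_congruentNumberCurve_two_mul_prod p hp hodd hinj rfl
  have hΩ : ((congruentNumberCurve (2 * ∏ i, p i)).realPeriodRat : ℂ) ≠ 0 := by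
    exact_mod_cast (congruentNumberCurve (2 * ∏ i, p i)).realPeriodRat_pos_holds.ne'
  have hR : ((congruentNumberCurve (2 * ∏ i, p i)).regulator : ℂ) ≠ 0 := by
    exact_mod_cast (congruentNumberCurve (2 * ∏ i, p i)).regulator_pos'.ne'
  have hden : ((congruentNumberCurve (2 * ∏ i, p i)).realPeriodRat : ℂ) * ((2 ^ (2 * 2 + 2) : ℕ) : ℂ) *
      ((congruentNumberCurve (2 * ∏ i, p i)).regulator : ℂ) ≠ 0 :=
    mul_ne_zero (mul_ne_zero hΩ (by norm_num)) hR
  have hsha := hy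
  rw [shaAn_def, hlead, hT, htam, div_eq_iff hden] at hsha
  push_cast at hsha
  have hderiv : deriv (congruentNumberCurve (2 * ∏ i, p i)).entireLFunction 1 =
      ((y * 4 : ℚ) : ℂ) *
        ((congruentNumberCurve (2 * ∏ i, p i)).realPeriodRat : ℂ) *
          ((congruentNumberCurve (2 * ∏ i, p i)).regulator : ℂ) := by
    push_cast
    linear_combination (1 / 16 : ℂ) * hsha
  have hy0 : y ≠ 0 := by
    rintro rfl
    apply hder
    rw [hderiv]; push_cast; ring
  have hy4 : y * 4 ≠ 0 := mul_ne_zero hy0 (by norm_num)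
  refine ⟨y * 4, hy4, hderiv, ?_⟩
  rw [show (y * 4 : ℚ) = y * ((2 ^ 2 : ℕ) : ℚ) by push_cast; ring, padicValRat.mul hy0 (by norm_num), hval,
    padicValRat.of_nat, padicValNat.prime_pow]
  norm_num

/-! ## §4 The rung from the 𝒮⁻ enclosure with Aoki's count — and the `hMe` twins without Rédei–Reichardt -/

/-- **THE SILENT `k = 2` RUNG from {`hAo`, `hSys′`}**: `𝒮⁻` is exactly the silent `s = 1` cell at `k = 2` (the
Rédei–Reichardt binder instantiated); C-P2-1 from the enclosure with Aoki's count. Conditional; nothing asserted.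
[cite: Aoki1999, Thm. 2.2 p. 81] [cite: Tian2014, Thm. 2.8 (J132)] [cite: TianYuanZhang2017, Thm. 1.2, Thm. 3.3]
[cite: Monsky1990MockHeegner, Remark (3) (p. 67)] [cite: LiMa2008, Thm. 0.4] -/
theorem congruentSilentEvenBSDTwoAt_two_of_genusSystem_of_aoki (hAo : thm22_card_selmerGroup_two)
    (hSys : tian2014_system_sMinus_genus) : CongruentSilentEvenBSDTwoAt 2 :=
  congruentSilentEvenBSDTwoAt_two_of_congruentSilentEvenFiveBSDTwo redeiReichardt_fourTwoCard_classGroup_holds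
    (congruentSilentEvenFiveBSDTwo_of_genusSystem_of_aoki hAo hSys)

/-- **THE `k = 2` RUNG `CongruentEvenBSDTwoAt 2` from {U⁺, GZK, `hAo`, `hSys′`}** — no Heath-Brown 1994 binder, no
Rédei–Reichardt binder, no Cor 5.15: the silent cells by the enclosure with Aoki's count, the loud cells by DOOR B6
with Aoki's count. Conditional; nothing asserted.
[cite: Aoki1999, Thm. 2.2 p. 81] [cite: TianYuanZhang2017, Thm. 1.2, Thm. 3.3, Thm. 3.5] [cite: Tian2014, Thm. 2.8 (J132)]
[cite: Monsky1990MockHeegner, Remark (3) (p. 67)] [cite: Miller2011LMS, Def. 1.1 (arXiv:1010.2431 p. 3)] -/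
theorem congruentEvenBSDTwoAt_two_of_genusSystem_of_aoki
    (hU : ∀ (n : ℕ), Squarefree n → (n % 8 = 5 ∨ n % 8 = 6 ∨ n % 8 = 7) →
      ∃ L : ℤ, IsScriptL n L ∧
        ((n % 8 = 5 ∨ n % 8 = 7) → (2 : ℤ) ∣ L →
          Even (genusSum₁ n fun d => genusClassNumber (GenusField d)) ∧
          Even (genusSum₂' n fun d => genusClassNumber (GenusField d))) ∧
        (n % 8 = 6 → (2 : ℤ) ∣ L → Even (genusSum₂' n fun d => genusClassNumber (GenusField d))))
    (hGZK : rank_eq_analyticRank_of_analyticRank_le_one) (hAo : thm22_card_selmerGroup_two)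
    (hSys : tian2014_system_sMinus_genus) : CongruentEvenBSDTwoAt 2 :=
  congruentEvenBSDTwoAt_two_of_congruentSilentEvenFiveBSDTwo_of_selmerEight hU hGZK (selmerEightAtTwo_of_aoki hAo)
    (congruentSilentEvenFiveBSDTwo_of_genusSystem_of_aoki hAo hSys)

/-- **THE `k = 2` RUNG, SHARPER FORM `CongruentEvenOrdTwoAt 2` from {U⁺, GZK, `hAo`, `hSys′`}.** Conditional;
nothing asserted. [cite: Aoki1999, Thm. 2.2 p. 81] [cite: TianYuanZhang2017, §1 (1.1), Thm. 3.3]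
[cite: Monsky1990MockHeegner, Remark (3) (p. 67)] -/
theorem congruentEvenOrdTwoAt_two_of_genusSystem_of_aoki
    (hU : ∀ (n : ℕ), Squarefree n → (n % 8 = 5 ∨ n % 8 = 6 ∨ n % 8 = 7) →
      ∃ L : ℤ, IsScriptL n L ∧
        ((n % 8 = 5 ∨ n % 8 = 7) → (2 : ℤ) ∣ L →
          Even (genusSum₁ n fun d => genusClassNumber (GenusField d)) ∧
          Even (genusSum₂' n fun d => genusClassNumber (GenusField d))) ∧
        (n % 8 = 6 → (2 : ℤ) ∣ L → Even (genusSum₂' n fun d => genusClassNumber (GenusField d))))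
    (hGZK : rank_eq_analyticRank_of_analyticRank_le_one) (hAo : thm22_card_selmerGroup_two)
    (hSys : tian2014_system_sMinus_genus) : CongruentEvenOrdTwoAt 2 :=
  congruentEvenOrdTwoAt_two_of_bsdTwoAt_of_selmerEight hGZK (selmerEightAtTwo_of_aoki hAo)
    (congruentEvenBSDTwoAt_two_of_genusSystem_of_aoki hU hGZK hAo hSys)

/-- **The `hMe` twin without Rédei–Reichardt**: `CongruentEvenBSDTwoAt 2` from {U⁺, GZK, `hMe`, `hSys′`} (the typer's
`congruentEvenBSDTwoAt_two_of_genusSystem_of_monskyEven` minus the binder `hR`). Conditional; nothing asserted.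
[cite: HeathBrown1994SelmerCongruentII, Appendix (Monsky)] [cite: TianYuanZhang2017, Thm. 1.2, Thm. 3.3, Thm. 3.5]
[cite: Tian2014, Thm. 2.8 (J132)] [cite: Monsky1990MockHeegner, Remark (3) (p. 67)] -/
theorem congruentEvenBSDTwoAt_two_of_genusSystem_of_monskyEven'
    (hU : ∀ (n : ℕ), Squarefree n → (n % 8 = 5 ∨ n % 8 = 6 ∨ n % 8 = 7) →
      ∃ L : ℤ, IsScriptL n L ∧
        ((n % 8 = 5 ∨ n % 8 = 7) → (2 : ℤ) ∣ L →
          Even (genusSum₁ n fun d => genusClassNumber (GenusField d)) ∧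
          Even (genusSum₂' n fun d => genusClassNumber (GenusField d))) ∧
        (n % 8 = 6 → (2 : ℤ) ∣ L → Even (genusSum₂' n fun d => genusClassNumber (GenusField d))))
    (hGZK : rank_eq_analyticRank_of_analyticRank_le_one) (hMe : monsky_card_selmerGroup_two_even)
    (hSys : tian2014_system_sMinus_genus) : CongruentEvenBSDTwoAt 2 :=
  congruentEvenBSDTwoAt_two_of_genusSystem_of_monskyEven hU hGZK hMe redeiReichardt_fourTwoCard_classGroup_holds hSys

end Summit.BirchSwinnertonDyer.Rank1Residual.P2

end
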